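import Summits.MatrixMultiplication.MatrixMultiplication.Theses.FidelityWitnesses
import Summits.MatrixMultiplication.MatrixMultiplication.Theorems.FidelityWitnessesDiagonalPowerDecayStubMatMulIsFlat
import Summits.MatrixMultiplication.MatrixMultiplication.Theorems.FidelityWitnessesDiagonalPowerDecayStubOrbitClosure
import Literature.Computability.AlgebraicComplexity.AlderStrassen

/-!
# Line `unit-tensor-orbit-nuclear-ratio` for crux `FidelityWitnesses.DiagonalPowerDecay` (stmt-MatrixMultiplication-14053)

LEAD'S SKELETON (prover-line-stmt-MatrixMultiplication-14053-1, 2026-08-16; reshaped from the planner's tree copy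
`Cruxes/DiagonalPowerDecay/Lines/unit_tensor_orbit_nuclear_ratio.lean`): the three registered stubs are restated over
Mathlib/Literature vocabulary ONLY (`IsFlat`, `vnorm`, `unitOrbit`, `orbitPt`, `IsNonneg`, `overlap`, `normSq` unfolded),
so each stub lands under `Theorems/` as a self-contained file without a Defs review; the def-forms `matMul_isFlat`,
`orbitClosure`, `nonnegFlatDecay` are recovered by `rfl`-bridges and feed the unchanged kernel-checked composition
`DiagonalPowerDecay_of`.  Mathematical content of every stub is unchanged.

Skeleton (crux-plan, opening round 1, planner-cruxplan-stmt-MatrixMultiplication-14053-unit-tensor-orbit-nu-0,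
2026-08-16) of idea card `Cruxes/DiagonalPowerDecay/Ideas/unit-tensor-orbit-nuclear-ratio.md` (crux-ideate r1,
ideator k = 2; merged by all three triagers with its twin `nuclear-distortion`); triage r1-1 / r1-2 / r1-3:
**pass / pass / pass (with doubt)** — the two recorded doubts and the r1-3 sharpening are built in (see below and
the line card `Lines/unit-tensor-orbit-nuclear-ratio.md`, § Triage answers).

THE CRUX. `DiagonalPowerDecay : ∃ C δ, 0 < δ ∧ ∀ n S, tensorRank S ≤ n² → ‖∑ S·⟨n,n,n⟩‖² ≤ C·n^{3−2δ}·∑‖S‖²`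
(`S : P n → P n → P n → ℂ`, `P n = Fin n × Fin n`; `φ(n) := M(n,n²)/n³ ≤ C n^{−2δ}`: `n²` border multiplications
capture only a power-small fraction of `n × n` matrix multiplication).

THE LINE (nuclear ratio on the orbit of the unit tensor), in the index-free format `(ℂ^ι)^{⊗3}`, `N := |ι|`
(the crux is the instance `ι = P n`, `N = n²`):
* LEVER (`stub_matMul_isFlat`, provable now): `⟨n,n,n⟩` is SPECTRALLY FLAT — `‖T‖_σ = 1`, i.e.
  `|∑ w_a u_b v_c T_abc| ≤ ‖w‖‖u‖‖v‖` (Derksen: `|tr|`-type bound `≤ ‖w‖_F ‖uv‖_F ≤ ‖w‖_F‖u‖_F‖v‖_F`). Hence for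
  every flat `Y` and EVERY decomposition `S = ∑_l w_l⊗u_l⊗v_l` of any length, `|⟨S,Y⟩| ≤ cost := ∑_l ‖w_l‖‖u_l‖‖v_l‖`
  (`overlap_le_cost`, PROVED): cheap decompositions bound all flat overlaps at once — the nuclear norm
  `‖S‖_* = min cost` is the line's currency.
* ONE ORBIT (`stub_orbitClosure`, provable now): in the format `ι³` the tensors of rank `≤ N` are exactly the images
  `(A,B,C)·I_N = orbitPt A B C` of the unit tensor under `End(ℂ^ι)³` (`tensorRank_orbitPt_le`, PROVED, and
  `exists_eq_sum_triad_of_tensorRank_le`), hence lie in the CLOSURE of the open orbit `unitOrbit ι = GL³·I_N`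
  (invertible matrices are dense, `orbitPt` is polynomial). So the crux's hypothesis `rank ≤ n²` is consumed
  here and only here (honouring `Disproof.false_without_rank`).
* THE OPEN STUB (`stub_nonnegFlatDecay`, XL) — the MULTIPLICATIVE-CLASS FIRST RUNG of the card's transfer, exactly
  as triage r1-3 asked ("restrict the first rung to the multiplicative class (dual certificate `Y ≥ 0`)"): for
  every finite `ι`, every entrywise NON-NEGATIVE flat target `Y` and every `S` on the open orbit,
  `|⟨S,Y⟩|² ≤ C·N^{3/2−δ}·‖S‖²`. It is `T`-free and format-free; STRICTLY BETWEEN the crux (the instance `Y = T_n`,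
  `ι = P n`) and the card's nuclear transfer C⁺ = `OrbitNuclearDecay` (= the same bound for ALL flat `Y`, i.e.
  `ν(N) = sup ‖S‖_*²/‖S‖² ≤ C N^{3/2−δ}`; `nonnegFlatDecay_of_orbitNuclearDecay`, PROVED, records that the card's
  mechanism — exhibiting cheap re-decompositions of orbit points — suffices); and, unlike C⁺ (whose ceiling
  `ν(N) = O(N^{3/2})` is itself open — triage doubt (i)), ITS `δ = 0` ENDPOINT IS A THEOREM: a non-negative flat
  `Y` has entries `≤ 1` and total mass `≤ N^{3/2}`, so `‖Y‖² ≤ N^{3/2}` and Cauchy–Schwarz gives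
  `|⟨S,Y⟩|² ≤ N^{3/2}‖S‖²` for EVERY `S` (`normSq_le_of_nonneg_flat`, `rung_endpoint`, PROVED) — the exact analogue
  of `Disproof.body_one_zero`: the whole content of the stub is the power saving, and `T_n` (`‖T‖² = n³ = N^{3/2}`)
  is an extreme point of the admissible target class.
* COMPOSITION (`DiagonalPowerDecay_of`, kernel-checked, no `sorry` of its own): the set
  `{S | |⟨S,T⟩|² ≤ C N^{3/2−δ}‖S‖²}` is closed (both sides continuous in `S`), contains the open orbit by the stub
  applied to `Y = T` (`T ≥ 0`, `isNonneg_matMulTensor`; `T` flat, `stub_matMul_isFlat`), hence contains its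
  closure, hence every `S` of rank `≤ n²` (`stub_orbitClosure`); finally `(n²)^{3/2−δ} = n^{3−2δ}` — the stub's
  `δ` IS the crux's `δ`, so every kernel-checked cap of `Cruxes/DiagonalPowerDecay/Disproof.lean` on the crux's
  exponent (`delta_le_half`, `delta_lt_of_strassen`, `delta_lt_three_sevenths`: `δ < 3/7`; § (f) certificates)
  is a cap on the stub's `δ` verbatim. Border points, where honest decompositions blow up (triage doubt (ii)),
  never need a decomposition: the estimate is proved on the OPEN orbit (invertible frames, unique rank-`N`
  decomposition by Kruskal, Kempf–Ness coordinates) and passes to the boundary by continuity.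

Disproof.lean (cdisprove cycle 1 + § (f), `Cruxes/DiagonalPowerDecay/Disproof.lean`; no `Negative/` lemma has
landed for this crux, nothing to import): `false_without_rank` honoured — the rank budget enters through
`stub_orbitClosure`, and the open stub is FALSE off the orbit (`S = Y = T_n`: ratio `n³ = N^{3/2}`, no decay;
`T_n ∉ closure(GL³·I_{n²})` since `bR(⟨n,n,n⟩) ≥ 2n² − n`); `body_one_zero` mirrored by `rung_endpoint`;
`dpd_iff_unit_constant` / `ratio_le_of_body` (the constant is immaterial, one exact data point caps `δ`) hold for
the stub on the non-negative class by the same Kronecker argument (overlap, `normSq`, `|ι|` and the orbit are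
multiplicative; flatness of `Y ⊠ Y'` for `Y, Y' ≥ 0` is Zhu–Chen–Hayashi arXiv:1002.2511), which is exactly the
card's finite-refutability protocol; `omega_ge_of_body`: the stub implies the crux with the same `δ`, hence
`ω(ℂ) ≥ 6/(3−2δ) > 2` — unavoidable for any sufficient condition (triage, cross-card notes). No stub is an
instance of a refuted statement of the negatives index (`ledger negatives --problem MatrixMultiplication`,
2026-08-16: four STPP / design refutations — stmt-7612, 9732, 9721, 8036 — unrelated).
-/

noncomputable section

namespace Summit.MatrixMultiplication.MatrixMultiplication.Cruxes.DiagonalPowerDecay.UnitTensorOrbitNuclearRatio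

open scoped BigOperators ComplexConjugate
open Literature.Computability.AlgebraicComplexity
open Summit.MatrixMultiplication.MatrixMultiplication.Theses.FidelityWitnesses (DiagonalPowerDecay)

set_option linter.unusedVariables false
set_option linter.dupNamespace false

/-! ## Vocabulary (format `(ℂ^ι)^{⊗3}`, `N = |ι|`; the crux is `ι = Fin n × Fin n`) -/

section Vocabulary

variable {ι : Type} [Fintype ι]

/-- The bilinear overlap `⟨S, Y⟩ := ∑ S_abc · Y_abc` — for `Y = matMulTensor ℂ n n n` this is literally the sum
squared on the left of the crux. -/
def overlap (S Y : ι → ι → ι → ℂ) : ℂ := ∑ a, ∑ b, ∑ c, S a b c * Y a b c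

/-- The squared Frobenius norm `‖S‖² = ∑ ‖S_abc‖²` (the sum on the right of the crux). -/
def normSq (S : ι → ι → ι → ℂ) : ℝ := ∑ a, ∑ b, ∑ c, ‖S a b c‖ ^ 2

/-- The `ℓ²` norm of a vector `x : ι → ℂ`. -/
def vnorm (x : ι → ℂ) : ℝ := Real.sqrt (∑ a, ‖x a‖ ^ 2)

/-- SPECTRAL FLATNESS `‖Y‖_σ ≤ 1`: every rank-one (triad) overlap is at most the product of the norms.
(`⟨n,n,n⟩` is flat — `stub_matMul_isFlat`; Derksen 2016, Thm 1.9 / Cor 1.10: `‖⟨p,q,r⟩‖_σ = 1`.) -/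
def IsFlat (Y : ι → ι → ι → ℂ) : Prop :=
  ∀ w u v : ι → ℂ, ‖∑ a, ∑ b, ∑ c, w a * u b * v c * Y a b c‖ ≤ vnorm w * vnorm u * vnorm v

/-- Entrywise NON-NEGATIVE (real) tensor — the MULTIPLICATIVE class of dual certificates: for such `Y, Y'` the
spectral norm is multiplicative under Kronecker products (Zhu–Chen–Hayashi 2010), so one certified violation of
the open stub powers up to a family (the card's finite-refutability protocol). `⟨n,n,n⟩` is `0/1`-valued. -/
def IsNonneg (Y : ι → ι → ι → ℂ) : Prop := ∀ a b c, ∃ t : ℝ, 0 ≤ t ∧ Y a b c = t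

/-- The image of the UNIT TENSOR `I_ι = ∑_l e_l ⊗ e_l ⊗ e_l` under the triple of matrices `(A, B, C)`:
`(A,B,C)·I = ∑_l A_{·l} ⊗ B_{·l} ⊗ C_{·l}`. Every tensor of rank `≤ |ι|` in the format `ι³` is of this form
(`exists_eq_sum_triad_of_tensorRank_le` + a bijection `Fin |ι| ≃ ι`), and conversely (`tensorRank_orbitPt_le`). -/
def orbitPt (A B C : Matrix ι ι ℂ) : ι → ι → ι → ℂ := fun a b c => ∑ l, A a l * B b l * C c l

/-- The NUCLEAR COST `∑_l ‖w_l‖ ‖u_l‖ ‖v_l‖` of an explicit decomposition `∑_l w_l ⊗ u_l ⊗ v_l`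
(`‖S‖_* = min` over all decompositions of `S`, Friedland–Lim arXiv:1410.6072; the minimum is attained). -/
def cost {m : ℕ} (w u v : Fin m → ι → ℂ) : ℝ := ∑ l, vnorm (w l) * vnorm (u l) * vnorm (v l)

end Vocabulary

/-- The OPEN ORBIT `GL(ℂ^ι)³ · I_ι` of the unit tensor: images under INVERTIBLE triples. Its closure is the set of
tensors of border rank `≤ |ι|` (degenerations of `⟨|ι|⟩`); it contains every tensor of rank `≤ |ι|`
(`stub_orbitClosure`). On the open orbit the rank-`|ι|` decomposition is unique up to the torus `⋊ S_ι`
(Kruskal, `|ι| ≥ 2`) and Kempf–Ness theory applies (`I_ι` is critical: all one-body marginals are `1`). -/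
def unitOrbit (ι : Type) [Fintype ι] [DecidableEq ι] : Set (ι → ι → ι → ℂ) :=
  {S | ∃ A B C : Matrix ι ι ℂ, IsUnit A.det ∧ IsUnit B.det ∧ IsUnit C.det ∧ S = orbitPt A B C}

/-- THE CARD'S TRANSFER `C⁺` ON THE ORBIT (`NuclearRatioDecay` / `ν(N) ≤ C·N^{3/2−δ}`), recorded as the line's
MECHANISM, not as an obligation: every point of the open orbit of `I_ι` has SOME decomposition (of any length)
whose nuclear cost² is `≤ C·|ι|^{3/2−δ}·‖S‖²` — "how nuclear can a rank-`N` tensor be" (matrices: `≤ rank`, by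
SVD re-orthogonalisation; tensors: the excess is border-rank cancellation, `W` gives `9/4 > 2`, `⟨m,m,m⟩` gives
`m³ = N^{3/ω_m}`). It implies the open stub for ALL flat targets (`nonnegFlatDecay_of_orbitNuclearDecay`,
proved); its own `δ = 0` ceiling `ν(N) = O(N^{3/2})` is OPEN (triage r1-2/r1-3), which is why the registered stub
is the non-negative rung, whose ceiling is proved (`rung_endpoint`). Known rigorous exponents from below:
`1.170` (`W`), `1.2546` (`ℂ[x₁..x₄]/𝔪²`, triage r1-2), `3/ω ≥ 1.265` (padded matrix multiplication); killer `3/2`. -/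
def OrbitNuclearDecay : Prop :=
  ∃ C δ : ℝ, 0 < δ ∧ ∀ (ι : Type) [Fintype ι] [DecidableEq ι], ∀ S ∈ unitOrbit ι,
    ∃ (m : ℕ) (w u v : Fin m → ι → ℂ), S = ∑ l, triad (w l) (u l) (v l) ∧
      cost w u v ^ 2 ≤ C * (Fintype.card ι : ℝ) ^ ((3 : ℝ) / 2 - δ) * normSq S

/-! ## The stubs -/

/-- **Stub 1 — the lever: `⟨n,n,n⟩` is spectrally flat (`‖⟨n,n,n⟩‖_σ = 1`).**
For `w, u, v : P n → ℂ` read as `n × n` matrices `W_{κν} = w (κ,ν)`, `U_{κμ} = u (κ,μ)`, `V_{μν} = v (μ,ν)`: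
`∑_{abc} w_a u_b v_c T_{abc} = ∑_{κμν} W_{κν} U_{κμ} V_{μν} = ∑_{κν} W_{κν} (UV)_{κν}`, so the modulus is
`≤ ‖W‖_F ‖UV‖_F ≤ ‖W‖_F ‖U‖_F ‖V‖_F` (Cauchy–Schwarz in `(κ,ν)`, then Frobenius submultiplicativity
`Matrix.frobenius_norm_mul` / Cauchy–Schwarz in `μ`). Equality at `w = u = v = 1_{1×1}`-type triads, so the
constant `1` is sharp. Source: Derksen 2016 (FoCM), Thm 1.9 / Cor 1.10; the sibling item
`ApproximationProfile.NuclearMass` (stmt-5019) is the same inequality in error form. Size M (index bookkeeping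
`P n = Fin n × Fin n`, two Cauchy–Schwarz steps). Why it might fail: it cannot (a printed theorem with a two-line
proof).
RESHAPED by the lead (2026-08-16, lead-1): stated over Mathlib/Literature vocabulary only (`IsFlat`, `vnorm` unfolded),
so that it lands under `Theorems/` without a Defs file; `matMul_isFlat` below is the def-form, by `rfl`. -/
theorem stub_matMul_isFlat :
    ∀ (n : ℕ) (w u v : Fin n × Fin n → ℂ),
      ‖∑ a, ∑ b, ∑ c, w a * u b * v c * matMulTensor ℂ n n n a b c‖ ≤
        Real.sqrt (∑ a, ‖w a‖ ^ 2) * Real.sqrt (∑ b, ‖u b‖ ^ 2) * Real.sqrt (∑ c, ‖v c‖ ^ 2) :=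
  -- LANDED (wave 1, p96489): `Theorems/FidelityWitnessesDiagonalPowerDecayStubMatMulIsFlat.lean`
  Summit.MatrixMultiplication.MatrixMultiplication.Theorems.DiagonalPowerDecay.stub_matMul_isFlat

/-- Def-form of Stub 1: `⟨n,n,n⟩` is flat. -/
theorem matMul_isFlat (n : ℕ) : IsFlat (matMulTensor ℂ n n n) :=
  fun w u v => stub_matMul_isFlat n w u v

/-- **Stub 2 — one orbit: rank `≤ |ι|` tensors are limits of the open `GL³`-orbit of the unit tensor.**
Why plausibly true (provable now): `tensorRank S ≤ |ι|` gives `S = ∑_{l : Fin |ι|} w_l ⊗ u_l ⊗ v_l`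
(`exists_eq_sum_triad_of_tensorRank_le`, padding with zero triads), i.e. `S = orbitPt A B C` with the factors as
columns after `Fintype.equivFin ι` (`Fintype.sum_equiv`). The polynomial `t ↦ det (A + t • 1)` is monic of degree
`|ι|` (it is `(−1)^{|ι|}·charpoly(−A)` up to sign conventions, `Matrix.charpoly_monic`), hence non-zero with
finitely many roots (`Polynomial.finite_setOf_isRoot`), so `A + t • 1`, `B + t • 1`, `C + t • 1` are simultaneously
invertible for all but finitely many `t`, in particular along a sequence `t_k → 0`; `orbitPt` is continuous
(indeed polynomial) in `(A, B, C)` jointly (finite sums of products of coordinates, `fun_prop`), so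
`orbitPt (A + t_k•1) (B + t_k•1) (C + t_k•1) → S` with every term in `unitOrbit ι` (`mem_closure_of_tendsto`).
Degenerate case `ι` empty: `det = 1`, `S = orbitPt 0 0 0 ∈ unitOrbit`. This is the formal content of the card's
"at the diagonal, rank `≤ n²` is the orbit closure of `I_{n²}`" (the inclusion used; the converse inclusion
closure ⊆ border rank `≤ |ι|` is Alder–Strassen and is not needed). Size M. Why it might fail: it cannot.
RESHAPED by the lead (2026-08-16, lead-1): `unitOrbit`/`orbitPt` unfolded, so the statement is Mathlib/Literature-only;
`orbitClosure` below is the def-form, by `rfl`. -/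
theorem stub_orbitClosure :
    ∀ (ι : Type) [Fintype ι] [DecidableEq ι] (S : ι → ι → ι → ℂ),
      tensorRank S ≤ Fintype.card ι →
        S ∈ closure {S' : ι → ι → ι → ℂ | ∃ A B C : Matrix ι ι ℂ,
          IsUnit A.det ∧ IsUnit B.det ∧ IsUnit C.det ∧ S' = fun a b c => ∑ l, A a l * B b l * C c l} :=
  -- LANDED (wave 1, p96508): `Theorems/FidelityWitnessesDiagonalPowerDecayStubOrbitClosure.lean`
  Summit.MatrixMultiplication.MatrixMultiplication.Theorems.DiagonalPowerDecay.stub_orbitClosure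

/-- The open orbit, unfolded (bridge between the registered def-free stubs and the workfile vocabulary). -/
theorem unitOrbit_eq (ι : Type) [Fintype ι] [DecidableEq ι] :
    unitOrbit ι = {S' : ι → ι → ι → ℂ | ∃ A B C : Matrix ι ι ℂ,
      IsUnit A.det ∧ IsUnit B.det ∧ IsUnit C.det ∧ S' = fun a b c => ∑ l, A a l * B b l * C c l} := rfl

/-- Def-form of Stub 2: rank `≤ |ι|` tensors lie in the closure of the open orbit of the unit tensor. -/
theorem orbitClosure (ι : Type) [Fintype ι] [DecidableEq ι] (S : ι → ι → ι → ℂ)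
    (hS : tensorRank S ≤ Fintype.card ι) : S ∈ closure (unitOrbit ι) := by
  rw [unitOrbit_eq]
  exact stub_orbitClosure ι S hS

/-- **Stub 3 — THE OPEN STUB (hardest): power decay of overlaps with non-negative flat targets, uniformly on the
orbits of the unit tensors.** For some `C` and `δ > 0`: for every finite index type `ι` (`N = |ι|`), every
entrywise non-negative `Y` with `‖Y‖_σ ≤ 1` and every `S = (A,B,C)·I_ι` with `A, B, C` invertible,
`|⟨S,Y⟩|² ≤ C·N^{3/2−δ}·‖S‖²`.
STATUS OF ITS PARTS. `δ = 0` is a theorem for ALL `S` (`rung_endpoint`: `‖Y‖² ≤ N^{3/2}` + Cauchy–Schwarz), so —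
as for the crux (`Disproof.body_one_zero`) — the content is exactly the power saving, and `0 < δ` cannot be
weakened; the orbit hypothesis is load-bearing (`S = Y = T_n` off the orbit has ratio `N^{3/2}`,
cf. `Disproof.false_without_rank`); `δ < 3/7` is forced (the stub gives the crux with the same `δ`;
`Disproof.delta_lt_three_sevenths`), informally `δ ≲ 0.235` (`ω < 2.3714`), and the conjectured truth is
`δ = 3/2 − 3/ω − o(1)`-ish along block matrix multiplication. By nuclear duality (`overlap_le_cost`) it suffices
to exhibit, for every orbit point, ONE decomposition of any length with `cost² ≤ C N^{3/2−δ}‖S‖²` — this is the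
card's transfer `OrbitNuclearDecay` (`nonnegFlatDecay_of_orbitNuclearDecay`); the honest frame `(A,B,C)` itself
settles the LOW-CANCELLATION regime `(∑_l ‖A_{·l}‖‖B_{·l}‖‖C_{·l}‖)² ≤ C N^{3/2−δ}‖S‖²` (e.g. one leg orthogonal, or
a Gram cube with non-negative real part: `cost² ≤ N‖S‖²`, the `δ = 1/2` shadow = triage-verified
`OrthogonalFrameLaw` / `PositiveGramLaw` / `OneLegOrthogonalBound`), so all difficulty sits in COHERENT CANCELLING
frames near the boundary of the orbit (border phenomena: `W = lim`, Bini, the `(2,4)` maximiser of the Disproof's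
numerics), uniformly up to the boundary. TOOLS the orbit exposes (card § Why (3), Transfer (iv)): Kruskal
uniqueness of the frame, Kempf–Ness / moment-map coordinates (`I_ι` critical, `‖g·I‖²` geodesically convex along
`exp(tX)`), the degeneration combinatorics of `⟨N⟩`, and the support-function form of the inner maximisation over
the convex set `{Y ≥ 0, ‖Y‖_σ ≤ 1}`. NECESSARY SHAPE OF A DANGEROUS TARGET (from flatness + non-negativity):
entries `≤ 1`, box masses `∑_{A×B×C} Y ≤ (|A||B||C|)^{1/2}` for all index boxes, total mass `≤ N^{3/2}` with
`‖Y‖² = N^{3/2}` iff `Y` is `0/1` with `N^{3/2}` ones (as `T_n`): a kill needs a near-maximal-mass flat `0/1`-like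
target ROBUSTLY of border rank `≤ N` — none is known (`bR(⟨n,n,n⟩) ≥ 2n² − n`, Landsberg–Ottaviani 2015).
EXPOSURE beyond the crux: other near-extremal non-negative flat targets (padded / blocked / Kronecker-twisted
matrix multiplication tensors, `W`, `ℂ[x₁..x_q]/𝔪²`, CW tensors — all non-negative); standing certified exponents
`1.170`, `1.2546`, `≥ 1.265` against the killer `3/2` (triage r1-2 § Kit part C, r1-3). FINITE REFUTABILITY: one
exact pair `(S₀ ∈ closure(GL³·I_{N₀}), Y₀ ≥ 0 flat)` with `|⟨S₀,Y₀⟩|² ≥ N₀^{3/2}‖S₀‖²`, `N₀ ≥ 2`, kills it by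
Kronecker powers (ZCH multiplicativity); any certified ratio `ρ₀` is the rigorous bound `δ ≤ 3/2 − log ρ₀/log N₀`.
Why it might fail: a near-maximal-mass non-negative flat target that IS robustly a degeneration of `⟨N⟩` along a
family (an `L²`-approximate bilinear scheme of rank `N` for a `T`-like target) — the same new phenomenon that would
kill the crux, now over a `T`-free class. Sources: Derksen 2016; Friedland–Lim arXiv:1410.6072; Zhu–Chen–Hayashi
arXiv:1002.2511; Bürgisser–Clausen–Shokrollahi 1997 §15.4–15.6 (degenerations of `⟨N⟩`);
Bürgisser–Franks–Garg–Oliveira–Walter–Wigderson arXiv:1804.04739 (tensor scaling / moment map);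
Landsberg–Ottaviani 2015. Size XL (open; implies `ω(ℂ) ≥ 6/(3−2δ)`).
RESHAPED by the lead (2026-08-16, lead-1): `IsNonneg`, `IsFlat`, `unitOrbit`, `overlap`, `normSq` unfolded, so the
statement is Mathlib/Literature-only; `nonnegFlatDecay` below is the def-form.  LEAD'S TIGHTNESS NOTE (this session):
Strassen's tensor `Str_q = Σ_{i≤q} (e₀⊗e_i⊗e_i + e_i⊗e₀⊗e_i)` is non-negative, flat, of border rank `q + 1`, with
`‖Str_q‖² = 2q`; its Kronecker powers (flat by the non-negative half of Zhu–Chen–Hayashi) force every witness here to have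
`δ ≤ 3/2 − log 6 / log 4 ≈ 0.2075` (`q = 3`) — strictly below every cap known for the crux. -/
theorem stub_nonnegFlatDecay :
    ∃ c δ : ℝ, 0 < δ ∧ ∀ (ι : Type) [Fintype ι] [DecidableEq ι] (Y : ι → ι → ι → ℂ),
      (∀ i j k, ∃ t : ℝ, 0 ≤ t ∧ Y i j k = t) →
      (∀ w u v : ι → ℂ, ‖∑ i, ∑ j, ∑ k, w i * u j * v k * Y i j k‖ ≤
        Real.sqrt (∑ i, ‖w i‖ ^ 2) * Real.sqrt (∑ j, ‖u j‖ ^ 2) * Real.sqrt (∑ k, ‖v k‖ ^ 2)) →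
      ∀ (A B C : Matrix ι ι ℂ), IsUnit A.det → IsUnit B.det → IsUnit C.det →
        ‖∑ i, ∑ j, ∑ k, (∑ l, A i l * B j l * C k l) * Y i j k‖ ^ 2 ≤
          c * (Fintype.card ι : ℝ) ^ ((3 : ℝ) / 2 - δ) *
            ∑ i, ∑ j, ∑ k, ‖∑ l, A i l * B j l * C k l‖ ^ 2 := by
  sorry

/-- Def-form of Stub 3 (the statement the composition consumes). -/
theorem nonnegFlatDecay :
    ∃ C δ : ℝ, 0 < δ ∧ ∀ (ι : Type) [Fintype ι] [DecidableEq ι] (Y : ι → ι → ι → ℂ),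
      IsNonneg Y → IsFlat Y → ∀ S ∈ unitOrbit ι,
        ‖overlap S Y‖ ^ 2 ≤ C * (Fintype.card ι : ℝ) ^ ((3 : ℝ) / 2 - δ) * normSq S := by
  obtain ⟨c, δ, hδ, h⟩ := stub_nonnegFlatDecay
  refine ⟨c, δ, hδ, fun ι _ _ Y hN hY S hS => ?_⟩
  obtain ⟨A, B, C, hA, hB, hC, rfl⟩ := hS
  exact h ι Y hN hY A B C hA hB hC

/-! ## Proved glue I — nuclear duality: cheap decompositions bound every flat overlap -/

section Glue

variable {ι : Type} [Fintype ι]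

/-- A triple sum as one sum over `ι × ι × ι`. -/
theorem sum3 {L : Type*} [AddCommMonoid L] (g : ι → ι → ι → L) :
    (∑ a, ∑ b, ∑ c, g a b c) = ∑ x : ι × ι × ι, g x.1 x.2.1 x.2.2 := by
  simp only [Fintype.sum_prod_type]

/-- The overlap is additive over a triad decomposition: `⟨∑_l w_l⊗u_l⊗v_l, Y⟩ = ∑_l ∑ w_l u_l v_l · Y`. -/
theorem overlap_sum_triad {m : ℕ} (w u v : Fin m → ι → ℂ) (Y : ι → ι → ι → ℂ) :
    overlap (∑ l, triad (w l) (u l) (v l)) Y = ∑ l, ∑ a, ∑ b, ∑ c, w l a * u l b * v l c * Y a b c := by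
  unfold overlap
  simp only [Finset.sum_apply, triad_apply, Finset.sum_mul]
  calc (∑ a, ∑ b, ∑ c, ∑ l, w l a * u l b * v l c * Y a b c)
      = ∑ a, ∑ b, ∑ l, ∑ c, w l a * u l b * v l c * Y a b c :=
        Finset.sum_congr rfl fun a _ => Finset.sum_congr rfl fun b _ => Finset.sum_comm
    _ = ∑ a, ∑ l, ∑ b, ∑ c, w l a * u l b * v l c * Y a b c :=
        Finset.sum_congr rfl fun a _ => Finset.sum_comm
    _ = ∑ l, ∑ a, ∑ b, ∑ c, w l a * u l b * v l c * Y a b c := Finset.sum_comm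

/-- **Nuclear duality.** For a flat target `Y`, EVERY decomposition of `S` bounds the overlap by its nuclear
cost: `|⟨S,Y⟩| ≤ ∑_l ‖w_l‖‖u_l‖‖v_l‖` (so `|⟨S,Y⟩| ≤ ‖S‖_*`; with `Y = ⟨n,n,n⟩` this is the card's
`SpectralFlatness ⇒ capture ≤ ‖S‖_*`). -/
theorem overlap_le_cost {Y : ι → ι → ι → ℂ} (hY : IsFlat Y) {m : ℕ} (w u v : Fin m → ι → ℂ) :
    ‖overlap (∑ l, triad (w l) (u l) (v l)) Y‖ ≤ cost w u v := by
  rw [overlap_sum_triad]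
  refine (norm_sum_le _ _).trans ?_
  unfold cost
  exact Finset.sum_le_sum fun l _ => hY (w l) (u l) (v l)

/-- The orbit point `(A,B,C)·I` is the triad sum of the columns. -/
theorem orbitPt_eq_sum_triad [DecidableEq ι] (A B C : Matrix ι ι ℂ) :
    orbitPt A B C = ∑ l, triad (fun a => A a l) (fun b => B b l) (fun c => C c l) := by
  funext a b c
  simp [orbitPt, Finset.sum_apply, triad_apply]

/-- Orbit points have rank `≤ |ι|`: the open stub speaks about (a dense part of) the crux's own domain. -/
theorem tensorRank_orbitPt_le [DecidableEq ι] (A B C : Matrix ι ι ℂ) :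
    tensorRank (orbitPt A B C) ≤ Fintype.card ι :=
  tensorRank_le_card_of_eq_sum _ _ _ (orbitPt_eq_sum_triad A B C)

end Glue

/-- **The card's mechanism suffices**: the nuclear transfer `C⁺` on the orbit implies the open stub (for all flat
targets, non-negative or not), by nuclear duality. -/
theorem nonnegFlatDecay_of_orbitNuclearDecay (h : OrbitNuclearDecay) :
    ∃ C δ : ℝ, 0 < δ ∧ ∀ (ι : Type) [Fintype ι] [DecidableEq ι] (Y : ι → ι → ι → ℂ),
      IsNonneg Y → IsFlat Y → ∀ S ∈ unitOrbit ι,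
        ‖overlap S Y‖ ^ 2 ≤ C * (Fintype.card ι : ℝ) ^ ((3 : ℝ) / 2 - δ) * normSq S := by
  obtain ⟨C, δ, hδ, h⟩ := h
  refine ⟨C, δ, hδ, fun ι _ _ Y _ hY S hS => ?_⟩
  obtain ⟨m, w, u, v, hSeq, hcost⟩ := h ι S hS
  calc ‖overlap S Y‖ ^ 2 = ‖overlap (∑ l, triad (w l) (u l) (v l)) Y‖ ^ 2 := by rw [hSeq]
    _ ≤ cost w u v ^ 2 := pow_le_pow_left₀ (norm_nonneg _) (overlap_le_cost hY w u v) 2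
    _ ≤ C * (Fintype.card ι : ℝ) ^ ((3 : ℝ) / 2 - δ) * normSq S := hcost

/-! ## Proved glue II — the `δ = 0` endpoint of the open stub is Cauchy–Schwarz (triage "stub 0", settled) -/

section Endpoint

variable {ι : Type} [Fintype ι]

/-- Cauchy–Schwarz for the overlap: `|⟨S,Y⟩|² ≤ ‖S‖² ‖Y‖²`. -/
theorem overlap_sq_le (S Y : ι → ι → ι → ℂ) : ‖overlap S Y‖ ^ 2 ≤ normSq S * normSq Y := by
  unfold overlap normSq
  rw [sum3, sum3 (fun a b c => ‖S a b c‖ ^ 2), sum3 (fun a b c => ‖Y a b c‖ ^ 2)]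
  calc ‖∑ x : ι × ι × ι, S x.1 x.2.1 x.2.2 * Y x.1 x.2.1 x.2.2‖ ^ 2
      ≤ (∑ x : ι × ι × ι, ‖S x.1 x.2.1 x.2.2‖ * ‖Y x.1 x.2.1 x.2.2‖) ^ 2 := by
        refine pow_le_pow_left₀ (norm_nonneg _) ?_ 2
        exact (norm_sum_le _ _).trans (le_of_eq (Finset.sum_congr rfl fun x _ => norm_mul _ _))
    _ ≤ (∑ x : ι × ι × ι, ‖S x.1 x.2.1 x.2.2‖ ^ 2) * ∑ x : ι × ι × ι, ‖Y x.1 x.2.1 x.2.2‖ ^ 2 :=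
        Finset.sum_mul_sq_le_sq_mul_sq _ _ _

/-- The indicator vector of a coordinate. -/
def ind [DecidableEq ι] (a : ι) : ι → ℂ := fun x => if x = a then 1 else 0

theorem vnorm_ind [DecidableEq ι] (a : ι) : vnorm (ind a) = 1 := by
  unfold vnorm ind
  have : (∑ x, ‖(if x = a then (1 : ℂ) else 0)‖ ^ 2) = 1 := by
    rw [Fintype.sum_eq_single a (fun x hx => by simp [hx])]
    simp
  rw [this, Real.sqrt_one]

/-- The all-ones vector has norm `√|ι|`. -/
theorem vnorm_one : vnorm (fun _ : ι => (1 : ℂ)) = Real.sqrt (Fintype.card ι) := by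
  unfold vnorm
  simp

/-- Flatness tested on indicator vectors: every entry of a flat tensor has modulus `≤ 1`. -/
theorem norm_entry_le_one_of_flat [DecidableEq ι] {Y : ι → ι → ι → ℂ} (hY : IsFlat Y) (a b c : ι) :
    ‖Y a b c‖ ≤ 1 := by
  have key := hY (ind a) (ind b) (ind c)
  have hsum : (∑ a', ∑ b', ∑ c', ind a a' * ind b b' * ind c c' * Y a' b' c') = Y a b c := by
    rw [Fintype.sum_eq_single a (fun a' ha' => by simp [ind, ha'])]
    rw [Fintype.sum_eq_single b (fun b' hb' => by simp [ind, hb'])]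
    rw [Fintype.sum_eq_single c (fun c' hc' => by simp [ind, hc'])]
    simp [ind]
  rw [hsum, vnorm_ind, vnorm_ind, vnorm_ind] at key
  simpa using key

/-- Flatness tested on the all-ones vectors: the total mass of a flat tensor is `≤ |ι|^{3/2}` in modulus. -/
theorem norm_sum_le_of_flat {Y : ι → ι → ι → ℂ} (hY : IsFlat Y) :
    ‖∑ a, ∑ b, ∑ c, Y a b c‖ ≤ (Fintype.card ι : ℝ) * Real.sqrt (Fintype.card ι) := by
  have key := hY (fun _ => 1) (fun _ => 1) (fun _ => 1)
  simp only [one_mul] at key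
  rw [vnorm_one] at key
  have hs : Real.sqrt (Fintype.card ι : ℝ) * Real.sqrt (Fintype.card ι) = Fintype.card ι :=
    Real.mul_self_sqrt (Nat.cast_nonneg _)
  calc ‖∑ a, ∑ b, ∑ c, Y a b c‖ ≤ Real.sqrt (Fintype.card ι) * Real.sqrt (Fintype.card ι) *
        Real.sqrt (Fintype.card ι) := key
    _ = (Fintype.card ι : ℝ) * Real.sqrt (Fintype.card ι) := by rw [hs]

/-- **The ceiling of the target class**: a non-negative flat tensor has `‖Y‖² ≤ |ι|^{3/2}` (entries in `[0,1]`,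
total mass `≤ |ι|^{3/2}`); `⟨n,n,n⟩` attains it (`n³ = (n²)^{3/2}`). -/
theorem normSq_le_of_nonneg_flat [DecidableEq ι] {Y : ι → ι → ι → ℂ} (hN : IsNonneg Y) (hY : IsFlat Y) :
    normSq Y ≤ (Fintype.card ι : ℝ) * Real.sqrt (Fintype.card ι) := by
  choose t ht using hN
  have hY' : ∀ a b c, Y a b c = (t a b c : ℂ) := fun a b c => (ht a b c).2
  have ht0 : ∀ a b c, 0 ≤ t a b c := fun a b c => (ht a b c).1
  have ht1 : ∀ a b c, t a b c ≤ 1 := by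
    intro a b c
    have h := norm_entry_le_one_of_flat hY a b c
    rw [hY', Complex.norm_real, Real.norm_of_nonneg (ht0 a b c)] at h
    exact h
  -- `‖Y‖² = ∑ t² ≤ ∑ t`
  have h1 : normSq Y ≤ ∑ a, ∑ b, ∑ c, t a b c := by
    unfold normSq
    refine Finset.sum_le_sum fun a _ => Finset.sum_le_sum fun b _ => Finset.sum_le_sum fun c _ => ?_
    rw [hY', Complex.norm_real, Real.norm_of_nonneg (ht0 a b c), sq]
    exact mul_le_of_le_one_right (ht0 a b c) (ht1 a b c)
  -- `∑ t = ‖∑ Y‖ ≤ N √N`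
  have h2 : (∑ a, ∑ b, ∑ c, t a b c) = ‖∑ a, ∑ b, ∑ c, Y a b c‖ := by
    have e : (∑ a, ∑ b, ∑ c, Y a b c) = ((∑ a, ∑ b, ∑ c, t a b c : ℝ) : ℂ) := by
      push_cast
      exact Finset.sum_congr rfl fun a _ => Finset.sum_congr rfl fun b _ =>
        Finset.sum_congr rfl fun c _ => hY' a b c
    rw [e, Complex.norm_real, Real.norm_of_nonneg]
    exact Finset.sum_nonneg fun a _ => Finset.sum_nonneg fun b _ => Finset.sum_nonneg fun c _ => ht0 a b c
  rw [h2] at h1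
  exact h1.trans (norm_sum_le_of_flat hY)

/-- `x · √x = x^{3/2}` for `x ≥ 0`. -/
theorem mul_sqrt_eq_rpow {x : ℝ} (hx : 0 ≤ x) : x * Real.sqrt x = x ^ ((3 : ℝ) / 2) := by
  rcases hx.lt_or_eq with hx' | hx'
  · rw [Real.sqrt_eq_rpow, show (3 : ℝ) / 2 = 1 + 1 / 2 by norm_num, Real.rpow_add hx', Real.rpow_one]
  · subst hx'
    simp [Real.zero_rpow (by norm_num : (3 : ℝ) / 2 ≠ 0)]

/-- **Rung endpoint (`δ = 0`, `C = 1`) — a theorem, for EVERY tensor `S` (no orbit hypothesis):**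
`|⟨S,Y⟩|² ≤ |ι|^{3/2} · ‖S‖²` for non-negative flat `Y`. The analogue of `Disproof.body_one_zero` for the open
stub: its content is exactly the power saving `δ > 0`, for which the orbit hypothesis is indispensable. -/
theorem rung_endpoint [DecidableEq ι] {Y : ι → ι → ι → ℂ} (hN : IsNonneg Y) (hY : IsFlat Y)
    (S : ι → ι → ι → ℂ) :
    ‖overlap S Y‖ ^ 2 ≤ (Fintype.card ι : ℝ) ^ ((3 : ℝ) / 2) * normSq S := by
  have h1 := overlap_sq_le S Y
  have h2 := normSq_le_of_nonneg_flat hN hY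
  rw [mul_sqrt_eq_rpow (Nat.cast_nonneg _)] at h2
  have hS : 0 ≤ normSq S := by
    unfold normSq; positivity
  calc ‖overlap S Y‖ ^ 2 ≤ normSq S * normSq Y := h1
    _ ≤ normSq S * (Fintype.card ι : ℝ) ^ ((3 : ℝ) / 2) := mul_le_mul_of_nonneg_left h2 hS
    _ = (Fintype.card ι : ℝ) ^ ((3 : ℝ) / 2) * normSq S := mul_comm _ _

end Endpoint

/-! ## Proved glue III — the target `⟨n,n,n⟩` and continuity -/

/-- `⟨n,n,n⟩` is `0/1`-valued, in particular entrywise non-negative. -/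
theorem isNonneg_matMulTensor (n : ℕ) : IsNonneg (matMulTensor ℂ n n n) := by
  intro a b c
  by_cases h : a.1 = b.1 ∧ b.2 = c.1 ∧ a.2 = c.2
  · exact ⟨1, zero_le_one, by simp [matMulTensor, h]⟩
  · exact ⟨0, le_rfl, by simp [matMulTensor, h]⟩

section Continuity

variable {ι : Type} [Fintype ι]

omit [Fintype ι] in
/-- Coordinate evaluation `S ↦ S a b c` is continuous. -/
theorem continuous_eval (a b c : ι) : Continuous fun S : ι → ι → ι → ℂ => S a b c := by
  fun_prop

/-- `S ↦ ⟨S, Y⟩` is continuous (a finite sum of coordinate functions times constants). -/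
theorem continuous_overlap_left (Y : ι → ι → ι → ℂ) :
    Continuous fun S : ι → ι → ι → ℂ => overlap S Y := by
  unfold overlap
  refine continuous_finsetSum _ fun a _ => continuous_finsetSum _ fun b _ =>
    continuous_finsetSum _ fun c _ => ?_
  exact (continuous_eval a b c).mul continuous_const

/-- `S ↦ ‖S‖²` is continuous. -/
theorem continuous_normSq : Continuous fun S : ι → ι → ι → ℂ => normSq S := by
  unfold normSq
  refine continuous_finsetSum _ fun a _ => continuous_finsetSum _ fun b _ =>
    continuous_finsetSum _ fun c _ => ?_
  exact ((continuous_eval a b c).norm).pow 2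

end Continuity

/-! ## The composition (kernel-checked, no `sorry` of its own) -/

/-- **`DiagonalPowerDecay` from the three stubs.** Take `(C, δ)` from Stub 3. For `S : P n → P n → P n → ℂ` of rank
`≤ n² = |P n|`, Stub 2 puts `S` in the closure of the open orbit of `I_{P n}`; the set
`{S' | |⟨S',T⟩|² ≤ C·|P n|^{3/2−δ}·‖S'‖²}` is closed (continuity) and contains the open orbit by Stub 3 applied to
the non-negative (`isNonneg_matMulTensor`) flat (Stub 1) target `T = ⟨n,n,n⟩`, hence contains `S`; and
`|P n|^{3/2−δ} = (n²)^{3/2−δ} = n^{3−2δ}`. -/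
theorem DiagonalPowerDecay_of : DiagonalPowerDecay := by
  obtain ⟨C, δ, hδ, hdec⟩ := nonnegFlatDecay
  refine ⟨C, δ, hδ, fun n S hS => ?_⟩
  have hcard : Fintype.card (Fin n × Fin n) = n ^ 2 := by
    simp [Fintype.card_prod, sq]
  -- the closed set cut out by the inequality, with the constant in `|P n|`-form
  have hclosed : IsClosed {S' : Fin n × Fin n → Fin n × Fin n → Fin n × Fin n → ℂ |
      ‖overlap S' (matMulTensor ℂ n n n)‖ ^ 2 ≤
        C * (Fintype.card (Fin n × Fin n) : ℝ) ^ ((3 : ℝ) / 2 - δ) * normSq S'} :=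
    isClosed_le (((continuous_overlap_left _).norm).pow 2) (continuous_const.mul continuous_normSq)
  have hsub : unitOrbit (Fin n × Fin n) ⊆ {S' : Fin n × Fin n → Fin n × Fin n → Fin n × Fin n → ℂ |
      ‖overlap S' (matMulTensor ℂ n n n)‖ ^ 2 ≤
        C * (Fintype.card (Fin n × Fin n) : ℝ) ^ ((3 : ℝ) / 2 - δ) * normSq S'} :=
    fun S' hS' => hdec (Fin n × Fin n) (matMulTensor ℂ n n n) (isNonneg_matMulTensor n)
      (matMul_isFlat n) S' hS'
  have hmem : S ∈ closure (unitOrbit (Fin n × Fin n)) :=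
    orbitClosure (Fin n × Fin n) S (by rw [hcard]; exact hS)
  have key : ‖overlap S (matMulTensor ℂ n n n)‖ ^ 2 ≤
      C * (Fintype.card (Fin n × Fin n) : ℝ) ^ ((3 : ℝ) / 2 - δ) * normSq S :=
    closure_minimal hsub hclosed hmem
  -- `|P n|^{3/2-δ} = n^{3-2δ}`
  have hpow : (Fintype.card (Fin n × Fin n) : ℝ) ^ ((3 : ℝ) / 2 - δ) = (n : ℝ) ^ (3 - 2 * δ) := by
    rw [hcard]
    push_cast
    rw [← Real.rpow_natCast (n : ℝ) 2, ← Real.rpow_mul (Nat.cast_nonneg n)]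
    congr 1
    push_cast
    ring
  rw [hpow] at key
  exact key

end Summit.MatrixMultiplication.MatrixMultiplication.Cruxes.DiagonalPowerDecay.UnitTensorOrbitNuclearRatio

end
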